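import Literature.NumberTheory.EllipticCurves.TwoDescentHalvingAlgEquiv
import HarnessLib
import HarnessLib.Audit.Tags

/-!
# The explicit halving point under a `K`-automorphism of `L ⊇ K`, part 2: THE READINGS of the Kummer cocycle of any half of a
# `K`-point through `T₁`, `T₂`, `T₃`, existence of the halving data over an algebraically closed `L`, and the halves of the `2`-torsion
# points themselves (cell `bsd-f2-manin`, seat `-es` g39, MEMO-es §60.8 «D4σ»; sibling of `TwoDescentHalvingAlgEquiv.lean`)

TYPER NOTE (typer g21, T-es-80, part 2 of 2).  SOURCE = HOME/es/g39/TwoDescentHalvingAlgEquiv-es-g39-v2.lean sha16 ce944fbd0e140afe, §§3–5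
(source ll. 293–557) VERBATIM, plus the private bookkeeping lemma `sign_iff_of_imp` moved here from §2 (its only users are the readings);
same namespace `WeierstrassCurve`, same `variable` block and `section Halving` re-opened with `[(W.baseChange L).IsElliptic]`; the public
`[folklore]` tags of `nonsingular_algebraMap`, `twoTorsionY_algebraMap`, `twoTorsion_eq_some_algebraMap`, `exists_sq_eq_twoTorsion_differences`
replaced by `[cite: SilvermanAEC2009, §X.1 …]` locators (Literature lint).  No def, no instance, net debt 0.  The V3 inputs LEAD p1 / p2 consume
are `map_sub_self_halfTwoTorsion_reading₁/₂/₃` (§5) and `exists_sq_eq_twoTorsion_differences`.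

## References
* [SilvermanAEC2009] J. H. Silverman, *The Arithmetic of Elliptic Curves*, 2nd ed., GTM 106, Springer 2009, §X.1: Thm. X.1.1 (and its
  proof), Prop. X.1.4.
* [Knapp1993] A. W. Knapp, *Elliptic Curves*, Princeton 1993, Thm. 4.2.
-/

noncomputable section

open scoped Classical

namespace WeierstrassCurve

open WeierstrassCurve.Affine WeierstrassCurve.Affine.Point

variable {K L : Type*} [Field K] [Field L] [CharZero L] [Algebra K L]
  {W : WeierstrassCurve K} {e₁ e₂ e₃ : K}

section Halving

variable [(W.baseChange L).IsElliptic]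

/-- Bookkeeping: from a sign `s ∈ {1, −1}` with one-way readings and disjoint targets to the two-way readings.
[folklore] -/
private theorem sign_iff_of_imp {s : L} {P R : Prop} (hs : s = 1 ∨ s = -1) (hP : s = 1 → P)
    (hR : s = -1 → R) (hPR : ¬ (P ∧ R)) : (s = 1 ↔ P) ∧ (s = -1 ↔ R) := by
  have h11 : (1 : L) ≠ -1 := by norm_num
  rcases hs with rfl | rfl
  · exact ⟨⟨hP, fun _ => rfl⟩, ⟨fun h' => absurd h' h11, fun hr => (hPR ⟨hP rfl, hr⟩).elim⟩⟩
  · exact ⟨⟨fun h' => absurd h'.symm h11, fun hp => (hPR ⟨hp, hR rfl⟩).elim⟩, ⟨hR, fun _ => rfl⟩⟩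

/-! ### §3 The dictionary: the Kummer cocycle of ANY half of a `K`-point, read through `T₁`, `T₂`, `T₃` -/

/-- **Reading through `T₁`.**  Let `P = (x₀, y₀) ∈ E(K)`, `uᵢ ∈ L` with `uᵢ² = ι(x₀ − eᵢ)`,
`u₁u₂u₃ = ι(y₀ + (a₁x₀ + a₃)/2)`, and `S ∈ E(L)` ANY point with `S + S = ιP`.  Then there is `s = ±1` with
`τu₁ = s·u₁` and `τ(u₂u₃) = s·u₂u₃`, and `s = 1 ↔ τS − S ∈ {O, T₁}`, `s = −1 ↔ τS − S ∈ {T₂, T₃}`: the Kummer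
cocycle of `P` read through `T₁` is the Kummer character of `x₀ − e₁` (of `(e₁ − e₂)(e₁ − e₃) = (u₂u₃)²` when
`x₀ = e₁`).  Silverman AEC X.1, proof of Thm. X.1.1. [cite: SilvermanAEC2009, Thm. X.1.1, Prop. X.1.4] -/
theorem map_sub_self_reading₁ (h : W.toAffine.SplitTwoTorsion e₁ e₂ e₃) (τ : L ≃ₐ[K] L) {x₀ y₀ : K}
    {u₁ u₂ u₃ : L}
    (hu₁ : algebraMap K L x₀ - algebraMap K L e₁ = u₁ ^ 2)
    (hu₂ : algebraMap K L x₀ - algebraMap K L e₂ = u₂ ^ 2)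
    (hu₃ : algebraMap K L x₀ - algebraMap K L e₃ = u₃ ^ 2)
    (hy₀ : algebraMap K L (y₀ + (W.a₁ * x₀ + W.a₃) / 2) = u₁ * u₂ * u₃)
    {h₀ : (W.baseChange L).toAffine.Nonsingular (algebraMap K L x₀) (algebraMap K L y₀)}
    {S : (W.baseChange L).toAffine.Point} (hS : S + S = Affine.Point.some _ _ h₀) :
    ∃ s : L, (s = 1 ∨ s = -1) ∧ τ u₁ = s * u₁ ∧ τ (u₂ * u₃) = s * (u₂ * u₃) ∧
      (s = 1 ↔ (Affine.Point.map (W' := W) (τ : L →ₐ[K] L) S - S = 0 ∨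
        Affine.Point.map (W' := W) (τ : L →ₐ[K] L) S - S =
          Affine.Point.some _ _ (Affine.nonsingular_twoTorsion (h.map L)))) ∧
      (s = -1 ↔ (Affine.Point.map (W' := W) (τ : L →ₐ[K] L) S - S =
          Affine.Point.some _ _ (Affine.nonsingular_twoTorsion (h.map L).swap₁₂) ∨
        Affine.Point.map (W' := W) (τ : L →ₐ[K] L) S - S =
          Affine.Point.some _ _ (Affine.nonsingular_twoTorsion (h.map L).swap₂₃.swap₁₂))) := by
  have hQQ := halving_add_self_algebraMap h hu₁ hu₂ hu₃ hy₀ (h₀ := h₀)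
  rw [map_sub_self_eq_of_add_self_eq h τ (hS.trans hQQ.symm)]
  have hPR := not_mem_zero_twoTorsion_and (L := L) h
    (D := Affine.Point.map (W' := W) (τ : L →ₐ[K] L)
      (Affine.Point.some _ _ (Affine.Point.nonsingular_halving (h.map L) hu₁ hu₂ hu₃)) -
      Affine.Point.some _ _ (Affine.Point.nonsingular_halving (h.map L) hu₁ hu₂ hu₃))
  rcases map_halving_sub_self_cases h τ hu₁ hu₂ hu₃ hy₀ rfl with
    ⟨h1, h2, h3, hD⟩ | ⟨h1, h2, h3, hD⟩ | ⟨h1, h2, h3, hD⟩ | ⟨h1, h2, h3, hD⟩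
  · refine ⟨1, Or.inl rfl, by rw [one_mul, h1], by rw [one_mul, map_mul, h2, h3], ?_⟩
    exact sign_iff_of_imp (Or.inl rfl) (fun _ => Or.inl hD) (fun h' => absurd h' (by norm_num)) hPR
  · refine ⟨1, Or.inl rfl, by rw [one_mul, h1], by rw [one_mul, map_mul, h2, h3]; ring, ?_⟩
    exact sign_iff_of_imp (Or.inl rfl) (fun _ => Or.inr hD) (fun h' => absurd h' (by norm_num)) hPR
  · refine ⟨-1, Or.inr rfl, by rw [h1]; ring, by rw [map_mul, h2, h3]; ring, ?_⟩
    exact sign_iff_of_imp (Or.inr rfl) (fun h' => absurd h'.symm (by norm_num)) (fun _ => Or.inl hD) hPR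
  · refine ⟨-1, Or.inr rfl, by rw [h1]; ring, by rw [map_mul, h2, h3]; ring, ?_⟩
    exact sign_iff_of_imp (Or.inr rfl) (fun h' => absurd h'.symm (by norm_num)) (fun _ => Or.inr hD) hPR

/-- **Reading through `T₂`**: a sign `s = ±1` with `τu₂ = s·u₂`, `τ(u₁u₃) = s·u₁u₃`, and
`s = 1 ↔ τS − S ∈ {O, T₂}`, `s = −1 ↔ τS − S ∈ {T₁, T₃}` (the Kummer character of `x₀ − e₂`, of
`(e₂ − e₁)(e₂ − e₃) = (u₁u₃)²` when `x₀ = e₂`). [cite: SilvermanAEC2009, Thm. X.1.1, Prop. X.1.4] -/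
theorem map_sub_self_reading₂ (h : W.toAffine.SplitTwoTorsion e₁ e₂ e₃) (τ : L ≃ₐ[K] L) {x₀ y₀ : K}
    {u₁ u₂ u₃ : L}
    (hu₁ : algebraMap K L x₀ - algebraMap K L e₁ = u₁ ^ 2)
    (hu₂ : algebraMap K L x₀ - algebraMap K L e₂ = u₂ ^ 2)
    (hu₃ : algebraMap K L x₀ - algebraMap K L e₃ = u₃ ^ 2)
    (hy₀ : algebraMap K L (y₀ + (W.a₁ * x₀ + W.a₃) / 2) = u₁ * u₂ * u₃)
    {h₀ : (W.baseChange L).toAffine.Nonsingular (algebraMap K L x₀) (algebraMap K L y₀)}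
    {S : (W.baseChange L).toAffine.Point} (hS : S + S = Affine.Point.some _ _ h₀) :
    ∃ s : L, (s = 1 ∨ s = -1) ∧ τ u₂ = s * u₂ ∧ τ (u₁ * u₃) = s * (u₁ * u₃) ∧
      (s = 1 ↔ (Affine.Point.map (W' := W) (τ : L →ₐ[K] L) S - S = 0 ∨
        Affine.Point.map (W' := W) (τ : L →ₐ[K] L) S - S =
          Affine.Point.some _ _ (Affine.nonsingular_twoTorsion (h.map L).swap₁₂))) ∧
      (s = -1 ↔ (Affine.Point.map (W' := W) (τ : L →ₐ[K] L) S - S =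
          Affine.Point.some _ _ (Affine.nonsingular_twoTorsion (h.map L)) ∨
        Affine.Point.map (W' := W) (τ : L →ₐ[K] L) S - S =
          Affine.Point.some _ _ (Affine.nonsingular_twoTorsion (h.map L).swap₂₃.swap₁₂))) := by
  have hQQ := halving_add_self_algebraMap h hu₁ hu₂ hu₃ hy₀ (h₀ := h₀)
  rw [map_sub_self_eq_of_add_self_eq h τ (hS.trans hQQ.symm)]
  -- disjointness `{O, T₂} ∩ {T₁, T₃} = ∅`, from the `T₁`-version for `h.swap₁₂`
  have hPR : ∀ {D : (W.baseChange L).toAffine.Point},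
      ¬ ((D = 0 ∨ D = Affine.Point.some _ _ (Affine.nonsingular_twoTorsion (h.map L).swap₁₂)) ∧
        (D = Affine.Point.some _ _ (Affine.nonsingular_twoTorsion (h.map L)) ∨
          D = Affine.Point.some _ _ (Affine.nonsingular_twoTorsion (h.map L).swap₂₃.swap₁₂))) := by
    intro D
    rintro ⟨hP | hP, hR | hR⟩ <;> rw [hP] at hR
    · exact twoTorsion_baseChange_ne_zero _ hR.symm
    · exact twoTorsion_baseChange_ne_zero _ hR.symm
    · exact (h.map L).ne₁₂ (Affine.Point.some.inj hR).1.symm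
    · exact (h.map L).ne₂₃ (Affine.Point.some.inj hR).1
  rcases map_halving_sub_self_cases h τ hu₁ hu₂ hu₃ hy₀ rfl with
    ⟨h1, h2, h3, hD⟩ | ⟨h1, h2, h3, hD⟩ | ⟨h1, h2, h3, hD⟩ | ⟨h1, h2, h3, hD⟩
  · refine ⟨1, Or.inl rfl, by rw [one_mul, h2], by rw [one_mul, map_mul, h1, h3], ?_⟩
    exact sign_iff_of_imp (Or.inl rfl) (fun _ => Or.inl hD) (fun h' => absurd h' (by norm_num)) hPR
  · refine ⟨-1, Or.inr rfl, by rw [h2]; ring, by rw [map_mul, h1, h3]; ring, ?_⟩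
    exact sign_iff_of_imp (Or.inr rfl) (fun h' => absurd h'.symm (by norm_num)) (fun _ => Or.inl hD) hPR
  · refine ⟨1, Or.inl rfl, by rw [one_mul, h2], by rw [one_mul, map_mul, h1, h3]; ring, ?_⟩
    exact sign_iff_of_imp (Or.inl rfl) (fun _ => Or.inr hD) (fun h' => absurd h' (by norm_num)) hPR
  · refine ⟨-1, Or.inr rfl, by rw [h2]; ring, by rw [map_mul, h1, h3]; ring, ?_⟩
    exact sign_iff_of_imp (Or.inr rfl) (fun h' => absurd h'.symm (by norm_num)) (fun _ => Or.inr hD) hPR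

/-- **Reading through `T₃`**: a sign `s = ±1` with `τu₃ = s·u₃`, `τ(u₁u₂) = s·u₁u₂`, and
`s = 1 ↔ τS − S ∈ {O, T₃}`, `s = −1 ↔ τS − S ∈ {T₁, T₂}` (the Kummer character of `x₀ − e₃`, of
`(e₃ − e₁)(e₃ − e₂) = (u₁u₂)²` when `x₀ = e₃`). [cite: SilvermanAEC2009, Thm. X.1.1, Prop. X.1.4] -/
theorem map_sub_self_reading₃ (h : W.toAffine.SplitTwoTorsion e₁ e₂ e₃) (τ : L ≃ₐ[K] L) {x₀ y₀ : K}
    {u₁ u₂ u₃ : L}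
    (hu₁ : algebraMap K L x₀ - algebraMap K L e₁ = u₁ ^ 2)
    (hu₂ : algebraMap K L x₀ - algebraMap K L e₂ = u₂ ^ 2)
    (hu₃ : algebraMap K L x₀ - algebraMap K L e₃ = u₃ ^ 2)
    (hy₀ : algebraMap K L (y₀ + (W.a₁ * x₀ + W.a₃) / 2) = u₁ * u₂ * u₃)
    {h₀ : (W.baseChange L).toAffine.Nonsingular (algebraMap K L x₀) (algebraMap K L y₀)}
    {S : (W.baseChange L).toAffine.Point} (hS : S + S = Affine.Point.some _ _ h₀) :
    ∃ s : L, (s = 1 ∨ s = -1) ∧ τ u₃ = s * u₃ ∧ τ (u₁ * u₂) = s * (u₁ * u₂) ∧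
      (s = 1 ↔ (Affine.Point.map (W' := W) (τ : L →ₐ[K] L) S - S = 0 ∨
        Affine.Point.map (W' := W) (τ : L →ₐ[K] L) S - S =
          Affine.Point.some _ _ (Affine.nonsingular_twoTorsion (h.map L).swap₂₃.swap₁₂))) ∧
      (s = -1 ↔ (Affine.Point.map (W' := W) (τ : L →ₐ[K] L) S - S =
          Affine.Point.some _ _ (Affine.nonsingular_twoTorsion (h.map L)) ∨
        Affine.Point.map (W' := W) (τ : L →ₐ[K] L) S - S =
          Affine.Point.some _ _ (Affine.nonsingular_twoTorsion (h.map L).swap₁₂))) := by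
  have hQQ := halving_add_self_algebraMap h hu₁ hu₂ hu₃ hy₀ (h₀ := h₀)
  rw [map_sub_self_eq_of_add_self_eq h τ (hS.trans hQQ.symm)]
  have hPR : ∀ {D : (W.baseChange L).toAffine.Point},
      ¬ ((D = 0 ∨ D = Affine.Point.some _ _ (Affine.nonsingular_twoTorsion (h.map L).swap₂₃.swap₁₂)) ∧
        (D = Affine.Point.some _ _ (Affine.nonsingular_twoTorsion (h.map L)) ∨
          D = Affine.Point.some _ _ (Affine.nonsingular_twoTorsion (h.map L).swap₁₂))) := by
    intro D
    rintro ⟨hP | hP, hR | hR⟩ <;> rw [hP] at hR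
    · exact twoTorsion_baseChange_ne_zero _ hR.symm
    · exact twoTorsion_baseChange_ne_zero _ hR.symm
    · exact (h.map L).ne₁₃ (Affine.Point.some.inj hR).1.symm
    · exact (h.map L).ne₂₃ (Affine.Point.some.inj hR).1.symm
  rcases map_halving_sub_self_cases h τ hu₁ hu₂ hu₃ hy₀ rfl with
    ⟨h1, h2, h3, hD⟩ | ⟨h1, h2, h3, hD⟩ | ⟨h1, h2, h3, hD⟩ | ⟨h1, h2, h3, hD⟩
  · refine ⟨1, Or.inl rfl, by rw [one_mul, h3], by rw [one_mul, map_mul, h1, h2], ?_⟩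
    exact sign_iff_of_imp (Or.inl rfl) (fun _ => Or.inl hD) (fun h' => absurd h' (by norm_num)) hPR
  · refine ⟨-1, Or.inr rfl, by rw [h3]; ring, by rw [map_mul, h1, h2]; ring, ?_⟩
    exact sign_iff_of_imp (Or.inr rfl) (fun h' => absurd h'.symm (by norm_num)) (fun _ => Or.inl hD) hPR
  · refine ⟨-1, Or.inr rfl, by rw [h3]; ring, by rw [map_mul, h1, h2]; ring, ?_⟩
    exact sign_iff_of_imp (Or.inr rfl) (fun h' => absurd h'.symm (by norm_num)) (fun _ => Or.inr hD) hPR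
  · refine ⟨1, Or.inl rfl, by rw [one_mul, h3], by rw [one_mul, map_mul, h1, h2]; ring, ?_⟩
    exact sign_iff_of_imp (Or.inl rfl) (fun _ => Or.inr hD) (fun h' => absurd h' (by norm_num)) hPR

/-! ### §4 Existence of the halving data over an algebraically closed `L` -/

omit [(W.baseChange L).IsElliptic] in
/-- **Over an algebraically closed `L` (e.g. `ℂ`) every `K`-point has halving data**: `uᵢ ∈ L` with
`uᵢ² = ι(x₀ − eᵢ)` and `u₁u₂u₃ = ι(y₀ + (a₁x₀ + a₃)/2)` (`exists_halving_roots` over `L`). [cite: Knapp1993, Thm. 4.2] -/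
theorem exists_halving_data [IsAlgClosed L] (h : W.toAffine.SplitTwoTorsion e₁ e₂ e₃) {x₀ y₀ : K}
    (h₀ : W.toAffine.Nonsingular x₀ y₀) :
    ∃ u₁ u₂ u₃ : L, algebraMap K L x₀ - algebraMap K L e₁ = u₁ ^ 2 ∧
      algebraMap K L x₀ - algebraMap K L e₂ = u₂ ^ 2 ∧ algebraMap K L x₀ - algebraMap K L e₃ = u₃ ^ 2 ∧
      algebraMap K L (y₀ + (W.a₁ * x₀ + W.a₃) / 2) = u₁ * u₂ * u₃ := by
  have h₀' : (W.baseChange L).toAffine.Nonsingular (algebraMap K L x₀) (algebraMap K L y₀) :=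
    (Affine.map_nonsingular (W := W.toAffine) (algebraMap K L).injective x₀ y₀).mpr h₀
  obtain ⟨u₁, u₂, u₃, hu₁, hu₂, hu₃, hy⟩ := Affine.Point.exists_halving_roots (h.map L) h₀'.left
  refine ⟨u₁, u₂, u₃, hu₁, hu₂, hu₃, ?_⟩
  rw [← hy]
  simp only [map_add, map_div₀, map_mul, map_ofNat, baseChange, map_a₁, map_a₃]

omit [CharZero L] [(W.baseChange L).IsElliptic] in
/-- The nonsingularity of a `K`-point persists over `L` (Mathlib `Affine.map_nonsingular`; recorded in the
form the readings consume). [cite: SilvermanAEC2009, §X.1 (set-up: `K`-points of `E` seen in `E(L)`)] -/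
theorem nonsingular_algebraMap {x₀ y₀ : K} (h₀ : W.toAffine.Nonsingular x₀ y₀) :
    (W.baseChange L).toAffine.Nonsingular (algebraMap K L x₀) (algebraMap K L y₀) :=
  (Affine.map_nonsingular (W := W.toAffine) (algebraMap K L).injective x₀ y₀).mpr h₀


/-! ### §5 Halves of the `2`-torsion points themselves (the diagonal entries of the descent table) -/

omit [CharZero L] [(W.baseChange L).IsElliptic] in
/-- The `y`-coordinate of `T₁` over `L` is the image of the one over `K`. [cite: SilvermanAEC2009, §X.1 (set-up: the `2`-torsion points `Tᵢ = (eᵢ, ·)` are `K`-rational)] -/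
theorem twoTorsionY_algebraMap (e : K) :
    (W.baseChange L).toAffine.twoTorsionY (algebraMap K L e) = algebraMap K L (W.toAffine.twoTorsionY e) := by
  simp only [Affine.twoTorsionY, map_neg, map_div₀, map_add, map_mul, map_ofNat, baseChange, map_a₁, map_a₃]

/-- `T₁ ∈ E(L)` written with both coordinates in `ι K`. [cite: SilvermanAEC2009, §X.1 (set-up: the `2`-torsion points `Tᵢ` are `K`-rational)] -/
theorem twoTorsion_eq_some_algebraMap (h : W.toAffine.SplitTwoTorsion e₁ e₂ e₃) :
    ∃ h₀ : (W.baseChange L).toAffine.Nonsingular (algebraMap K L e₁)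
        (algebraMap K L (W.toAffine.twoTorsionY e₁)),
      (Affine.Point.some _ _ (Affine.nonsingular_twoTorsion (h.map L)) : (W.baseChange L).toAffine.Point) =
        Affine.Point.some _ _ h₀ := by
  have hY := twoTorsionY_algebraMap (W := W) (L := L) e₁
  refine ⟨by rw [← hY]; exact Affine.nonsingular_twoTorsion (h.map L), ?_⟩
  rw [Affine.Point.some.injEq]
  exact ⟨rfl, hY⟩

/-- **A half of `T₁` read through `T₁` (diagonal entry).**  If `S + S = T₁` and `u₂² = ι(e₁ − e₂)`, `u₃² = ι(e₁ − e₃)`, then for a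
sign `s = ±1`: `τ(u₂u₃) = s·u₂u₃`, `s = 1 ↔ τS − S ∈ {O, T₁}`, `s = −1 ↔ τS − S ∈ {T₂, T₃}` — the Kummer character of
`δ₁(T₁) = (e₁ − e₂)(e₁ − e₃)` (for halves of `T₂`, `T₃` apply to `h.swap₁₂`, `h.swap₂₃.swap₁₂`).
[cite: SilvermanAEC2009, Thm. X.1.1, Prop. X.1.4] -/
theorem map_sub_self_halfTwoTorsion_reading₁ (h : W.toAffine.SplitTwoTorsion e₁ e₂ e₃) (τ : L ≃ₐ[K] L)
    {u₂ u₃ : L}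
    (hu₂ : algebraMap K L e₁ - algebraMap K L e₂ = u₂ ^ 2)
    (hu₃ : algebraMap K L e₁ - algebraMap K L e₃ = u₃ ^ 2)
    {S : (W.baseChange L).toAffine.Point}
    (hS : S + S = Affine.Point.some _ _ (Affine.nonsingular_twoTorsion (h.map L))) :
    ∃ s : L, (s = 1 ∨ s = -1) ∧ τ (u₂ * u₃) = s * (u₂ * u₃) ∧
      (s = 1 ↔ (Affine.Point.map (W' := W) (τ : L →ₐ[K] L) S - S = 0 ∨
        Affine.Point.map (W' := W) (τ : L →ₐ[K] L) S - S =
          Affine.Point.some _ _ (Affine.nonsingular_twoTorsion (h.map L)))) ∧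
      (s = -1 ↔ (Affine.Point.map (W' := W) (τ : L →ₐ[K] L) S - S =
          Affine.Point.some _ _ (Affine.nonsingular_twoTorsion (h.map L).swap₁₂) ∨
        Affine.Point.map (W' := W) (τ : L →ₐ[K] L) S - S =
          Affine.Point.some _ _ (Affine.nonsingular_twoTorsion (h.map L).swap₂₃.swap₁₂))) := by
  obtain ⟨h₀, hT⟩ := twoTorsion_eq_some_algebraMap (L := L) h
  rw [hT] at hS
  have hu₁ : algebraMap K L e₁ - algebraMap K L e₁ = (0 : L) ^ 2 := by ring
  have hy₀ : algebraMap K L (W.toAffine.twoTorsionY e₁ + (W.a₁ * e₁ + W.a₃) / 2) = 0 * u₂ * u₃ := by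
    have h0 : W.toAffine.twoTorsionY e₁ + (W.a₁ * e₁ + W.a₃) / 2 = 0 := by
      simp only [Affine.twoTorsionY]; ring
    rw [h0, _root_.map_zero]; ring
  obtain ⟨s, hs, -, h23, hiff⟩ := map_sub_self_reading₁ h τ hu₁ hu₂ hu₃ hy₀ hS
  exact ⟨s, hs, h23, hiff⟩

/-- **A half of `T₁` read through `T₂` (off-diagonal entry).**  If `S + S = T₁` and `u₂² = ι(e₁ − e₂)` then for a sign `s = ±1`:
`τu₂ = s·u₂`, `s = 1 ↔ τS − S ∈ {O, T₂}`, `s = −1 ↔ τS − S ∈ {T₁, T₃}` — the Kummer character of `δ₂(T₁) = e₁ − e₂`.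
[cite: SilvermanAEC2009, Thm. X.1.1, Prop. X.1.4] -/
theorem map_sub_self_halfTwoTorsion_reading₂ (h : W.toAffine.SplitTwoTorsion e₁ e₂ e₃) (τ : L ≃ₐ[K] L)
    {u₂ u₃ : L}
    (hu₂ : algebraMap K L e₁ - algebraMap K L e₂ = u₂ ^ 2)
    (hu₃ : algebraMap K L e₁ - algebraMap K L e₃ = u₃ ^ 2)
    {S : (W.baseChange L).toAffine.Point}
    (hS : S + S = Affine.Point.some _ _ (Affine.nonsingular_twoTorsion (h.map L))) :
    ∃ s : L, (s = 1 ∨ s = -1) ∧ τ u₂ = s * u₂ ∧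
      (s = 1 ↔ (Affine.Point.map (W' := W) (τ : L →ₐ[K] L) S - S = 0 ∨
        Affine.Point.map (W' := W) (τ : L →ₐ[K] L) S - S =
          Affine.Point.some _ _ (Affine.nonsingular_twoTorsion (h.map L).swap₁₂))) ∧
      (s = -1 ↔ (Affine.Point.map (W' := W) (τ : L →ₐ[K] L) S - S =
          Affine.Point.some _ _ (Affine.nonsingular_twoTorsion (h.map L)) ∨
        Affine.Point.map (W' := W) (τ : L →ₐ[K] L) S - S =
          Affine.Point.some _ _ (Affine.nonsingular_twoTorsion (h.map L).swap₂₃.swap₁₂))) := by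
  obtain ⟨h₀, hT⟩ := twoTorsion_eq_some_algebraMap (L := L) h
  rw [hT] at hS
  have hu₁ : algebraMap K L e₁ - algebraMap K L e₁ = (0 : L) ^ 2 := by ring
  have hy₀ : algebraMap K L (W.toAffine.twoTorsionY e₁ + (W.a₁ * e₁ + W.a₃) / 2) = 0 * u₂ * u₃ := by
    have h0 : W.toAffine.twoTorsionY e₁ + (W.a₁ * e₁ + W.a₃) / 2 = 0 := by
      simp only [Affine.twoTorsionY]; ring
    rw [h0, _root_.map_zero]; ring
  obtain ⟨s, hs, h2, -, hiff⟩ := map_sub_self_reading₂ h τ hu₁ hu₂ hu₃ hy₀ hS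
  exact ⟨s, hs, h2, hiff⟩

/-- **A half of `T₁` read through `T₃` (off-diagonal entry).**  If `S + S = T₁` and `u₃² = ι(e₁ − e₃)` then for a sign `s = ±1`:
`τu₃ = s·u₃`, `s = 1 ↔ τS − S ∈ {O, T₃}`, `s = −1 ↔ τS − S ∈ {T₁, T₂}` — the Kummer character of `δ₃(T₁) = e₁ − e₃`.
[cite: SilvermanAEC2009, Thm. X.1.1, Prop. X.1.4] -/
theorem map_sub_self_halfTwoTorsion_reading₃ (h : W.toAffine.SplitTwoTorsion e₁ e₂ e₃) (τ : L ≃ₐ[K] L)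
    {u₂ u₃ : L}
    (hu₂ : algebraMap K L e₁ - algebraMap K L e₂ = u₂ ^ 2)
    (hu₃ : algebraMap K L e₁ - algebraMap K L e₃ = u₃ ^ 2)
    {S : (W.baseChange L).toAffine.Point}
    (hS : S + S = Affine.Point.some _ _ (Affine.nonsingular_twoTorsion (h.map L))) :
    ∃ s : L, (s = 1 ∨ s = -1) ∧ τ u₃ = s * u₃ ∧
      (s = 1 ↔ (Affine.Point.map (W' := W) (τ : L →ₐ[K] L) S - S = 0 ∨
        Affine.Point.map (W' := W) (τ : L →ₐ[K] L) S - S =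
          Affine.Point.some _ _ (Affine.nonsingular_twoTorsion (h.map L).swap₂₃.swap₁₂))) ∧
      (s = -1 ↔ (Affine.Point.map (W' := W) (τ : L →ₐ[K] L) S - S =
          Affine.Point.some _ _ (Affine.nonsingular_twoTorsion (h.map L)) ∨
        Affine.Point.map (W' := W) (τ : L →ₐ[K] L) S - S =
          Affine.Point.some _ _ (Affine.nonsingular_twoTorsion (h.map L).swap₁₂))) := by
  obtain ⟨h₀, hT⟩ := twoTorsion_eq_some_algebraMap (L := L) h
  rw [hT] at hS
  have hu₁ : algebraMap K L e₁ - algebraMap K L e₁ = (0 : L) ^ 2 := by ring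
  have hy₀ : algebraMap K L (W.toAffine.twoTorsionY e₁ + (W.a₁ * e₁ + W.a₃) / 2) = 0 * u₂ * u₃ := by
    have h0 : W.toAffine.twoTorsionY e₁ + (W.a₁ * e₁ + W.a₃) / 2 = 0 := by
      simp only [Affine.twoTorsionY]; ring
    rw [h0, _root_.map_zero]; ring
  obtain ⟨s, hs, h3, -, hiff⟩ := map_sub_self_reading₃ h τ hu₁ hu₂ hu₃ hy₀ hS
  exact ⟨s, hs, h3, hiff⟩

end Halving

omit [CharZero L] in
/-- **Square roots of `ι(e₁ − e₂)`, `ι(e₁ − e₃)` exist over an algebraically closed `L`** (the data of the three corollaries above).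
[cite: SilvermanAEC2009, §X.1, proof of Prop. X.1.4 (the fields `K(√(eᵢ − eⱼ))`)] -/
theorem exists_sq_eq_twoTorsion_differences [IsAlgClosed L] (e₁ e₂ e₃ : K) :
    ∃ u₂ u₃ : L, algebraMap K L e₁ - algebraMap K L e₂ = u₂ ^ 2 ∧
      algebraMap K L e₁ - algebraMap K L e₃ = u₃ ^ 2 := by
  obtain ⟨u₂, hu₂⟩ := IsAlgClosed.exists_pow_nat_eq (algebraMap K L e₁ - algebraMap K L e₂) two_pos
  obtain ⟨u₃, hu₃⟩ := IsAlgClosed.exists_pow_nat_eq (algebraMap K L e₁ - algebraMap K L e₃) two_pos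
  exact ⟨u₂, u₃, hu₂.symm, hu₃.symm⟩

end WeierstrassCurve

end
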